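import Summits.NavierStokesRegularity.NavierStokesRegularity.Theses.PalasekTowerBreakdown
import Summits.NavierStokesRegularity.FluidComputer.PalasekTowerRegisterGlobalHalves
import Summits.NavierStokesRegularity.FluidComputer.PalasekTowerRegisterGlobalCoreFloors

/-!
# NavierStokesRegularity — route `PalasekTowerBreakdown`: the child crux `HeredityFromTwo` read through
# the Kelvin-critical conjunct of its lower stub — necessary readout numbers and refutation templates

Supports `stmt-NavierStokesRegularity-19250` (`PalasekTowerBreakdown.HeredityFromTwo := HeredityFrom 2`;
registered skeleton `Cruxes/HeredityFromTwo/Lines/birth.lean`, stubs `stub_continuation_envelope :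
ContinuationEnvelope` / `stub_readout_floors : ReadoutFloors`). Cell `ns-blowup`, seat
`ns-blowup-ecbridge-5` (g3). LABEL: E–C typing (glue over the landed register files
`PalasekTowerRegisterGlobalHalves` (p419350) and `PalasekTowerRegisterGlobalCoreFloors`). WHAT THIS IS NOT:
not NS — no stage, tower or instance is constructed; the child crux is OPEN and not claimed here; every
theorem below has it as hypothesis or concludes its NEGATION from an explicitly typed witness hypothesis
that nobody has instantiated.

The LOWER stub `ReadoutFloors` asks, of every finite-energy classical continuation of a registered stage at
a level `k ≥ 2` inside the next ceiling, three floors of level `k + 1` at `τ (k+1)`: velocity `c₁ Y_{k+1}`,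
strain `c₁ A_{k+1}`, and the core-ledger clause (a closed `C¹` loop of speed `≤ 8π/N_{k+1}` in a ball of
radius `1/N_{k+1}` centred in the tower's ball with circulation `≥ c₁ N_{k+1}^{β-2}`).
`PalasekTowerRegisterGlobalCoreFloors` shows that the core clause alone carries the other two up to the
constant `8π` and the ball slack `1/N_{k+1}`, and that the ceiling caps the core's circulation at
`8π c₂ N_{k+1}^{β-2}`. Against the ROUTE DECLS, by name:

* §1 necessary readout numbers: `palasekTowerBreakdown_heredityFromTwo_core_circulation_band` — under the
  child crux every registered stage at `k ≥ 2` extends to one whose level-`(k+1)` core carries circulation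
  in `[N_{k+1}^{3/10}, (40π/3) N_{k+1}^{3/10}]` (the circulation Reynolds number of the hand-over, fixed
  factor `40π/3 ≈ 41.9`); `palasekTowerBreakdown_heredityFromTwo_weak_floors` — under the child crux every
  finite-energy classical continuation of a registered stage at `k ≥ 2` inside the next ceiling shows at
  `τ (k+1)`, within `radius + 1/N_{k+1}`, speed `≥ c₁ Y_{k+1}/(8π)` and strain `≥ c₁ A_{k+1}/(8π)`;
  the parent `EpisodeInduction` gives the same (`palasekTowerBreakdown_episodeInduction_weak_floors`).
* §2 refutation templates (what a certified counterexample must show — NO loop search needed):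
  `palasekTowerBreakdown_not_heredityFromTwo_of_slow_readout` — ONE registered stage at some `k ≥ 2` of a
  pinned rigid quiet schedule together with ONE finite-energy classical continuation inside the next
  ceiling whose speed at `τ (k+1)` stays `< c₁ Y_{k+1}/(8π)` throughout the ball of radius
  `radius + 1/N_{k+1}` refutes the child crux (hence the parent,
  `palasekTowerBreakdown_not_episodeInduction_of_slow_readout`); likewise a continuation whose strain at
  `τ (k+1)` stays `< c₁ A_{k+1}/(8π)` there (`…_of_unstrained_readout`). The witness hypotheses are inline
  `∃`-statements over the register's own types; none is asserted.

References: S. Palasek, arXiv:2605.13827 §3.1, §4 [cite: Palasek2026ElementaryModel, §3–§4];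
A. J. Majda, A. L. Bertozzi, *Vorticity and Incompressible Flow*, CUP 2002, §1.6 eq. (1.57)
[cite: MajdaBertozziCUP2002, §1.6].
-/

-- `Summit.<Summit>.<Problem>` is the tree's mandated summit-side namespace (CONVENTIONS §2); for this
-- single-conjunct summit the two coincide, so the duplicate is deliberate.
set_option linter.dupNamespace false

noncomputable section

namespace Summit.NavierStokesRegularity.NavierStokesRegularity.Theorems

open Set MeasureTheory Real
open scoped ENNReal
open Summit.NavierStokesRegularity.NavierStokesRegularity.Theses
open Summit.NavierStokesRegularity.FluidComputer.PalasekTowerClayBridge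
open Literature.Analysis.FluidPDE

/-! ## §1 Necessary readout numbers under the child crux -/

/-- **The circulation Reynolds number of the hand-over, under the child crux.** If
`PalasekTowerBreakdown.HeredityFromTwo` holds, every globally anchored registered stage at a level `k ≥ 2`
of a pinned, rigid, quiet schedule on the wide rates extends to a stage at level `k + 1` whose recorded
level-`(k+1)` core loop (speed `≤ 8π/N_{k+1}`, inside a ball of radius `1/N_{k+1}` centred in the tower's
ball) carries circulation in the band `[N_{k+1}^{3/10}, (40π/3) N_{k+1}^{3/10}]` at unit viscosity — floor
by the ledger, cap by the new stage's own ceiling (`Stage.routeG_core_circulation_band_rigid`).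
[cite: Palasek2026ElementaryModel, §3.1] -/
theorem palasekTowerBreakdown_heredityFromTwo_core_circulation_band
    (h : PalasekTowerBreakdown.HeredityFromTwo) :
    ∀ S : Schedule TowerRates.wide, S.Pins 8 (6 / 5) → S.Rigid → S.Quiet → ∀ k : ℕ, 2 ≤ k →
    ∀ s : Stage 1 TowerRates.wide S (Margins.routeG TowerRates.wide) k,
    ∃ s' : Stage 1 TowerRates.wide S (Margins.routeG TowerRates.wide) (k + 1), s.Extends s' ∧
      ∃ (x : EuclideanSpace ℝ (Fin 3)) (γ : ℝ → EuclideanSpace ℝ (Fin 3)),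
        ‖x‖ ≤ S.radius ∧ ContDiff ℝ 1 γ ∧ γ 0 = γ 1 ∧
        (∀ σ ∈ Icc (0 : ℝ) 1, γ σ ∈ Metric.closedBall x (1 / TowerRates.wide.N (k + 1))) ∧
        (∀ σ ∈ Icc (0 : ℝ) 1, ‖deriv γ σ‖ ≤ 8 * π / TowerRates.wide.N (k + 1)) ∧
        TowerRates.wide.N (k + 1) ^ (3 / 10 : ℝ) ≤ circulation (s'.u (S.τ (k + 1))) γ ∧
        circulation (s'.u (S.τ (k + 1))) γ ≤ 40 * π / 3 * TowerRates.wide.N (k + 1) ^ (3 / 10 : ℝ) := by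
  intro S hP hR hQ k hk s
  obtain ⟨s', hs'⟩ := h S hP hR hQ k hk s
  exact ⟨s', hs', s'.routeG_core_circulation_band_rigid le_rfl⟩

/-- **Weak floors near the ball, under the child crux.** If `PalasekTowerBreakdown.HeredityFromTwo`
holds then (through `ReadoutFloors`, a consequence of the child by silent-window uniqueness, and its core
conjunct alone) every finite-energy classical continuation of a registered stage at a level `k ≥ 2`
inside the next ceiling shows, at `τ (k+1)` and within `radius + 1/N_{k+1}` of the origin, speed
`≥ c₁ Y_{k+1} / (8π)` and strain `≥ c₁ A_{k+1} / (8π)`. [cite: Palasek2026ElementaryModel, §3.1] -/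
theorem palasekTowerBreakdown_heredityFromTwo_weak_floors (h : PalasekTowerBreakdown.HeredityFromTwo) :
    ∀ S : Schedule TowerRates.wide, S.Pins 8 (6 / 5) → S.Rigid → S.Quiet → ∀ k : ℕ, 2 ≤ k →
    ∀ s : Stage 1 TowerRates.wide S (Margins.routeG TowerRates.wide) k,
    ∀ (u : ℝ → EuclideanSpace ℝ (Fin 3) → EuclideanSpace ℝ (Fin 3))
      (p : ℝ → EuclideanSpace ℝ (Fin 3) → ℝ),
      IsClassicalNSSolutionOn (Icc 0 (S.τ (k + 1))) 1 S.f u p →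
      (∀ t ∈ Icc 0 (S.τ k), u t = s.u t ∧ p t = s.p t) →
      (∃ C : ℝ≥0∞, C < ⊤ ∧ ∀ t ∈ Icc 0 (S.τ (k + 1)), ∫⁻ x, ‖u t x‖ₑ ^ 2 ≤ C) →
      (∀ t ∈ Icc 0 (S.τ (k + 1)), ∀ x, ‖u t x‖ ≤ S.c₂ * TowerRates.wide.Y (k + 1)) →
      (∃ y, ‖y‖ ≤ S.radius + 1 / TowerRates.wide.N (k + 1) ∧
        S.c₁ * TowerRates.wide.Y (k + 1) / (8 * π) ≤ ‖u (S.τ (k + 1)) y‖) ∧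
      (∃ y, ‖y‖ ≤ S.radius + 1 / TowerRates.wide.N (k + 1) ∧
        S.c₁ * TowerRates.wide.A (k + 1) / (8 * π) ≤ ‖fderiv ℝ (u (S.τ (k + 1))) y‖) :=
  (ReadoutFloors.of_heredityFrom_two h).weak_floors_of_core

/-- The same weak floors under the PARENT crux `PalasekTowerBreakdown.EpisodeInduction` (which contains
heredity from level `2`). [cite: Palasek2026ElementaryModel, §4] -/
theorem palasekTowerBreakdown_episodeInduction_weak_floors (h : PalasekTowerBreakdown.EpisodeInduction) :
    ∀ S : Schedule TowerRates.wide, S.Pins 8 (6 / 5) → S.Rigid → S.Quiet → ∀ k : ℕ, 2 ≤ k →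
    ∀ s : Stage 1 TowerRates.wide S (Margins.routeG TowerRates.wide) k,
    ∀ (u : ℝ → EuclideanSpace ℝ (Fin 3) → EuclideanSpace ℝ (Fin 3))
      (p : ℝ → EuclideanSpace ℝ (Fin 3) → ℝ),
      IsClassicalNSSolutionOn (Icc 0 (S.τ (k + 1))) 1 S.f u p →
      (∀ t ∈ Icc 0 (S.τ k), u t = s.u t ∧ p t = s.p t) →
      (∃ C : ℝ≥0∞, C < ⊤ ∧ ∀ t ∈ Icc 0 (S.τ (k + 1)), ∫⁻ x, ‖u t x‖ₑ ^ 2 ≤ C) →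
      (∀ t ∈ Icc 0 (S.τ (k + 1)), ∀ x, ‖u t x‖ ≤ S.c₂ * TowerRates.wide.Y (k + 1)) →
      (∃ y, ‖y‖ ≤ S.radius + 1 / TowerRates.wide.N (k + 1) ∧
        S.c₁ * TowerRates.wide.Y (k + 1) / (8 * π) ≤ ‖u (S.τ (k + 1)) y‖) ∧
      (∃ y, ‖y‖ ≤ S.radius + 1 / TowerRates.wide.N (k + 1) ∧
        S.c₁ * TowerRates.wide.A (k + 1) / (8 * π) ≤ ‖fderiv ℝ (u (S.τ (k + 1))) y‖) :=
  palasekTowerBreakdown_heredityFromTwo_weak_floors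
    ((episodeInductionG_iff_heredityAtOne_and_heredityFrom_two.1 h).2)

/-! ## §2 Refutation templates: a slow or unstrained readout of ONE registered stage refutes the child -/

/-- **Refutation template (speed).** ONE pinned, rigid, quiet schedule on the wide rates with ONE globally
anchored registered stage at some level `k ≥ 2` and ONE finite-energy classical continuation of it to
`τ (k+1)` inside the next ceiling `c₂ Y_{k+1}` whose speed at `τ (k+1)` stays BELOW `c₁ Y_{k+1} / (8π)`
throughout the ball of radius `radius + 1/N_{k+1}` refutes `PalasekTowerBreakdown.HeredityFromTwo` (the
core conjunct of `ReadoutFloors` would force such a speed on the new core loop — no loop search is needed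
to certify the failure). The hypothesis is a typed witness; none is asserted. [cite: Palasek2026ElementaryModel, §3.1] -/
theorem palasekTowerBreakdown_not_heredityFromTwo_of_slow_readout
    (hW : ∃ (S : Schedule TowerRates.wide) (k : ℕ)
      (s : Stage 1 TowerRates.wide S (Margins.routeG TowerRates.wide) k)
      (u : ℝ → EuclideanSpace ℝ (Fin 3) → EuclideanSpace ℝ (Fin 3))
      (p : ℝ → EuclideanSpace ℝ (Fin 3) → ℝ),
      S.Pins 8 (6 / 5) ∧ S.Rigid ∧ S.Quiet ∧ 2 ≤ k ∧
      IsClassicalNSSolutionOn (Icc 0 (S.τ (k + 1))) 1 S.f u p ∧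
      (∀ t ∈ Icc 0 (S.τ k), u t = s.u t ∧ p t = s.p t) ∧
      (∃ C : ℝ≥0∞, C < ⊤ ∧ ∀ t ∈ Icc 0 (S.τ (k + 1)), ∫⁻ x, ‖u t x‖ₑ ^ 2 ≤ C) ∧
      (∀ t ∈ Icc 0 (S.τ (k + 1)), ∀ x, ‖u t x‖ ≤ S.c₂ * TowerRates.wide.Y (k + 1)) ∧
      (∀ y, ‖y‖ ≤ S.radius + 1 / TowerRates.wide.N (k + 1) →
        ‖u (S.τ (k + 1)) y‖ < S.c₁ * TowerRates.wide.Y (k + 1) / (8 * π))) :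
    ¬ PalasekTowerBreakdown.HeredityFromTwo := by
  intro h
  obtain ⟨S, k, s, u, p, hP, hR, hQ, hk, hcl, hagree, hE, hceil, hslow⟩ := hW
  obtain ⟨⟨y, hy, hge⟩, -⟩ :=
    palasekTowerBreakdown_heredityFromTwo_weak_floors h S hP hR hQ k hk s u p hcl hagree hE hceil
  exact absurd hge (not_le.2 (hslow y hy))

/-- **Refutation template (strain).** The same with the strain: ONE finite-energy classical continuation
of a registered stage at `k ≥ 2` inside the next ceiling whose velocity GRADIENT at `τ (k+1)` stays below
`c₁ A_{k+1} / (8π)` throughout the ball of radius `radius + 1/N_{k+1}` refutes the child crux.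
[cite: Palasek2026ElementaryModel, §3.1] -/
theorem palasekTowerBreakdown_not_heredityFromTwo_of_unstrained_readout
    (hW : ∃ (S : Schedule TowerRates.wide) (k : ℕ)
      (s : Stage 1 TowerRates.wide S (Margins.routeG TowerRates.wide) k)
      (u : ℝ → EuclideanSpace ℝ (Fin 3) → EuclideanSpace ℝ (Fin 3))
      (p : ℝ → EuclideanSpace ℝ (Fin 3) → ℝ),
      S.Pins 8 (6 / 5) ∧ S.Rigid ∧ S.Quiet ∧ 2 ≤ k ∧
      IsClassicalNSSolutionOn (Icc 0 (S.τ (k + 1))) 1 S.f u p ∧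
      (∀ t ∈ Icc 0 (S.τ k), u t = s.u t ∧ p t = s.p t) ∧
      (∃ C : ℝ≥0∞, C < ⊤ ∧ ∀ t ∈ Icc 0 (S.τ (k + 1)), ∫⁻ x, ‖u t x‖ₑ ^ 2 ≤ C) ∧
      (∀ t ∈ Icc 0 (S.τ (k + 1)), ∀ x, ‖u t x‖ ≤ S.c₂ * TowerRates.wide.Y (k + 1)) ∧
      (∀ y, ‖y‖ ≤ S.radius + 1 / TowerRates.wide.N (k + 1) →
        ‖fderiv ℝ (u (S.τ (k + 1))) y‖ < S.c₁ * TowerRates.wide.A (k + 1) / (8 * π))) :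
    ¬ PalasekTowerBreakdown.HeredityFromTwo := by
  intro h
  obtain ⟨S, k, s, u, p, hP, hR, hQ, hk, hcl, hagree, hE, hceil, hflat⟩ := hW
  obtain ⟨-, ⟨y, hy, hge⟩⟩ :=
    palasekTowerBreakdown_heredityFromTwo_weak_floors h S hP hR hQ k hk s u p hcl hagree hE hceil
  exact absurd hge (not_le.2 (hflat y hy))

/-- **… and the parent falls with the child**: a slow readout of one registered stage at `k ≥ 2` refutes
`PalasekTowerBreakdown.EpisodeInduction` as well. [cite: Palasek2026ElementaryModel, §4] -/
theorem palasekTowerBreakdown_not_episodeInduction_of_slow_readout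
    (hW : ∃ (S : Schedule TowerRates.wide) (k : ℕ)
      (s : Stage 1 TowerRates.wide S (Margins.routeG TowerRates.wide) k)
      (u : ℝ → EuclideanSpace ℝ (Fin 3) → EuclideanSpace ℝ (Fin 3))
      (p : ℝ → EuclideanSpace ℝ (Fin 3) → ℝ),
      S.Pins 8 (6 / 5) ∧ S.Rigid ∧ S.Quiet ∧ 2 ≤ k ∧
      IsClassicalNSSolutionOn (Icc 0 (S.τ (k + 1))) 1 S.f u p ∧
      (∀ t ∈ Icc 0 (S.τ k), u t = s.u t ∧ p t = s.p t) ∧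
      (∃ C : ℝ≥0∞, C < ⊤ ∧ ∀ t ∈ Icc 0 (S.τ (k + 1)), ∫⁻ x, ‖u t x‖ₑ ^ 2 ≤ C) ∧
      (∀ t ∈ Icc 0 (S.τ (k + 1)), ∀ x, ‖u t x‖ ≤ S.c₂ * TowerRates.wide.Y (k + 1)) ∧
      (∀ y, ‖y‖ ≤ S.radius + 1 / TowerRates.wide.N (k + 1) →
        ‖u (S.τ (k + 1)) y‖ < S.c₁ * TowerRates.wide.Y (k + 1) / (8 * π))) :
    ¬ PalasekTowerBreakdown.EpisodeInduction := fun h =>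
  palasekTowerBreakdown_not_heredityFromTwo_of_slow_readout hW
    ((episodeInductionG_iff_heredityAtOne_and_heredityFrom_two.1 h).2)

end Summit.NavierStokesRegularity.NavierStokesRegularity.Theorems

end
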